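import Literature.AnabelianGeometry.EtaleTheta.Discharge.Sec4LevelSaturationThetaTwistTower
import Literature.AnabelianGeometry.EtaleTheta.Discharge.Sec5OfQuotientTemperoid
import HarnessLib

/-!
# [EtTh] Prop. 4.2 (iii) AS TYPED — POSITIVE at the FOURTH tower model over abc-iut-L2-t3's QUOTIENT-TEMPEROID §4 setting: the Def. 4.1 (ii)
# Galois datum CONSTRUCTED, the only displayed input the group-side quotient `φ : Π^tp_X ↠ Compat₃′`

S. Mochizuki, *The étale theta function and its Frobenioid-theoretic manifestations*, Publ. RIMS **45** (2009) [MochizukiEtTh2009], Def. 4.1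
(ii) PDF p.87 («the natural surjective outer homomorphism `Π^tp_X ↠ Aut_D(A^bs)`»), Prop. 4.2 (iii) PDF p.88–90
[cite: MochizukiEtTh2009, Prop 4.2 (iii) p.88]; [SemiAnbd] Rmk. 3.1.2–3.1.3 pp.33–34; [FrdI] Thm. 5.2 (i) p.100 (`(G/M, 0)` Frobenius-trivial).

abc-iut cell, layer L2 [EtTh], DAG node `EtTh:Prop4.2(iii)` (abc-iut-L2-lead R1035/R1184: first POSITIVE instance cell); seat abc-iut-w6-d037
(gen 6), row «P42III-POSITIVE@FOURTH-MODEL», the NON-OVERLAPPING sequel of abc-iut-L2-d2's knit `Sec4LevelSaturationThetaTwistTower`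
(`levelSaturation'`, `prop42_iii` at `mkOfModelCanonical` modulo the displayed naturality datum `hS`).  PROOF-ONLY (0 `def`s, 0 instances;
nothing landed is edited or restated).  Consumed BY NAME: abc-iut-L2-d2's `ThetaTwistTowerTempered.levelSaturation'` (level-wise
`μ_K`-saturation at the fourth model, p5009xx; underneath: their MU-TORSION (M3) p500836 and abc-iut-w6-d037's `isMuSaturated_of_bZero_generator`
p496075), abc-iut-w6-d037's `prop42_iii_of_levelSaturation'` (p499861: `Φ` divisorial, `hDSpull` p496921, root law `hR`, refinement `hE` all
discharged there), abc-iut-L2-t3's socket `BiKummerSetting.mkOfQuotientTemperoid` / `mkOfQuotientTemperoid_galoisSurj_natural` /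
`quotConnZeroObj` (p496301) and `isTemperedC` (abc-iut-L1-t6).
* **`prop42_iii_mkOfQuotientTemperoid R S X φ hφ A₀ hA₀ hA₀'`** — [EtTh] Prop. 4.2 (iii) AS TYPED (`BiKummerSetting.Prop42_iii`, trivial
  `(N,H)`-slot, genuine transport `pullFracModel`) HOLDS for the §4 setting `mkOfQuotientTemperoid X isTemperedC φ hφ
  (ThetaTwistTowerTempered.temperedFrobenioid R S) …` — the Galois surjections ARE `galoisSurjOf⁰ ∘ φ` and their Def. 4.1 (ii) naturality
  is the THEOREM `mkOfQuotientTemperoid_galoisSurj_natural`, so abc-iut-L2-d2's displayed binder `hS` DISAPPEARS: the only displayed input is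
  `φ : Π^tp_X ↠ Compat₃′` (memo (J3b) of abc-iut-L2-t3: the Setting's compatible Kummer-class system — not in the tree, not claimed here).
* `exists_anchor` — the family of settings is INHABITED: `(Compat₃′/M, 0)` is a Frobenius-trivial object with Galois base for every open
  normal `M` (abc-iut-L2-t3's `quotConnZeroObj`).
HONEST FRAMING: class-(b) combinatorial design carrier (NOT the tempered Frobenioid of a Tate curve; (β) deviation of record: the torsion sign
of Prop. 1.4 (ii) is not carried); trivial `(N,H)`-slot (the cohomological [FrdII] Def. 2.2 (ii) reading = GAP G-w4d044-2 stays open); the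
universe of `X` is that of the index category (F-L2t3g9-1; the Type-0 re-indexing (U1) is abc-iut-L2-t3's row); an instance at OUR model is
not print's universal statement; [EtTh]/[SemiAnbd]/[FrdI] are refereed prerequisite papers; nothing here bears on, or takes a side on, the
disputed [IUTchIII] Cor. 3.12; nothing here asserts abc proved or refuted.
-/

noncomputable section

namespace Literature.AnabelianGeometry.EtaleTheta

open CategoryTheory Opposite Function Literature.AlgebraicGeometry.Frobenioids Literature.AnabelianGeometry.SemiGraphs
  Literature.AlgebraicGeometry.Frobenioids.QuasiTemperoid LogDivisorModel LogDivisorModel.GaloisAction LogDivisorTower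

namespace ThetaTwistTowerTempered

open LogDivisorModel.TateTowerThetaTwist TateTowerKummerTwistRShear

variable (R S : ((ConnectedPart (BTemp (Compat 3 thetaShear)))ᵒᵖ ⥤ CommMonCat.{0}) → Prop)
  {K : Type 1} [Field K] (X : SemiGraphs.TemperedArithmeticGroup.{1} K)

/-- **[EtTh] Prop. 4.2 (iii) AS TYPED — POSITIVE INSTANCE over the QUOTIENT-TEMPEROID §4 setting** of abc-iut-L2-t3 at the fourth tower
model of record: for every vocabulary `R S`, every tempered arithmetic group `X`, every continuous SURJECTION `φ : Π^tp_X ↠ Compat₃′` and every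
Frobenius-trivial Galois-based anchor `A_⊙`, the setting `mkOfQuotientTemperoid X isTemperedC φ hφ tf …` (Galois surjections
`galoisSurjOf⁰ ∘ φ`, trivial `(N,H)`-slot) satisfies «every fraction-pair for `f` over `A_⊙` has an `N`-th root for every `N ≥ 1`» — NO
law-level hypothesis and NO displayed naturality datum. [cite: MochizukiEtTh2009, Prop 4.2 (iii) p.88] -/
theorem prop42_iii_mkOfQuotientTemperoid (φ : X.Pi →ₜ* Compat 3 thetaShear) (hφ : Function.Surjective φ)
    (A₀ : (ThetaTwistTowerTempered.temperedFrobenioid R S).category)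
    (hA₀ : PreFrobenioid.IsFrobeniusTrivial (ThetaTwistTowerTempered.temperedFrobenioid R S).toElem A₀)
    (hA₀' : IsGaloisObj A₀.base.obj) :
    (BiKummerSetting.mkOfQuotientTemperoid X (isTemperedC 3 thetaShear) φ hφ (ThetaTwistTowerTempered.temperedFrobenioid R S)
        (monoidType_eq R S) (hP R S) (fun _ _ _ => True) A₀ hA₀ hA₀').Prop42_iii
      (fun {_ _} ψ x => (ThetaTwistTowerTempered.temperedFrobenioid R S).pullFracModel ψ x) :=
  prop42_iii_of_levelSaturation' R S X _ _ A₀ hA₀ hA₀' (levelSaturation' R S)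
    (BiKummerSetting.mkOfQuotientTemperoid_galoisSurj_natural X (isTemperedC 3 thetaShear) φ hφ
      (ThetaTwistTowerTempered.temperedFrobenioid R S) (monoidType_eq R S) (hP R S) (fun _ _ _ => True) A₀ hA₀ hA₀')

/-- **The family of settings is inhabited**: for every open normal subgroup `M ⊴ Compat₃′` the object `(Compat₃′/M, 0)` of the fourth model
is Frobenius-trivial with Galois base ([FrdI] Thm. 5.2 (i); [SemiAnbd] Rmk. 3.1.3) — an admissible anchor `A_⊙` above.
[cite: MochizukiEtTh2009, Def 4.1 p.86] -/
theorem exists_anchor (M : OpenNormalSubgroup (Compat 3 thetaShear)) :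
    ∃ A₀ : (ThetaTwistTowerTempered.temperedFrobenioid R S).category,
      PreFrobenioid.IsFrobeniusTrivial (ThetaTwistTowerTempered.temperedFrobenioid R S).toElem A₀ ∧ IsGaloisObj A₀.base.obj :=
  ⟨(ThetaTwistTowerTempered.temperedFrobenioid R S).quotConnZeroObj (isTemperedC 3 thetaShear) M,
    (ThetaTwistTowerTempered.temperedFrobenioid R S).isFrobeniusTrivial_quotConnZeroObj (isTemperedC 3 thetaShear) M,
    (ThetaTwistTowerTempered.temperedFrobenioid R S).isGaloisObj_quotConnZeroObj_base (isTemperedC 3 thetaShear) M⟩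

/-- **Prop. 4.2 (iii) at the canonical anchor `(Compat₃′/M, 0)`** — the fully explicit instance (vocabulary `R S`, `X`, surjection `φ`,
open normal `M`). [cite: MochizukiEtTh2009, Prop 4.2 (iii) p.88] -/
theorem prop42_iii_mkOfQuotientTemperoid_quotConnZeroObj (φ : X.Pi →ₜ* Compat 3 thetaShear) (hφ : Function.Surjective φ)
    (M : OpenNormalSubgroup (Compat 3 thetaShear)) :
    (BiKummerSetting.mkOfQuotientTemperoid X (isTemperedC 3 thetaShear) φ hφ (ThetaTwistTowerTempered.temperedFrobenioid R S)
        (monoidType_eq R S) (hP R S) (fun _ _ _ => True)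
        ((ThetaTwistTowerTempered.temperedFrobenioid R S).quotConnZeroObj (isTemperedC 3 thetaShear) M)
        ((ThetaTwistTowerTempered.temperedFrobenioid R S).isFrobeniusTrivial_quotConnZeroObj (isTemperedC 3 thetaShear) M)
        ((ThetaTwistTowerTempered.temperedFrobenioid R S).isGaloisObj_quotConnZeroObj_base (isTemperedC 3 thetaShear) M)).Prop42_iii
      (fun {_ _} ψ x => (ThetaTwistTowerTempered.temperedFrobenioid R S).pullFracModel ψ x) :=
  prop42_iii_mkOfQuotientTemperoid R S X φ hφ _ _ _

end ThetaTwistTowerTempered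

end Literature.AnabelianGeometry.EtaleTheta

end
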